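/-
Origin: expansion seat `planner-pub-hodgecm-pv14-g2-0`, handover 2026-08-18 (`HOME/pub-hodgecm-pv14-g2/lean/Pv14g2/PerL34/P43LeavesSmoke.lean`, md5 ad644ce7, 180 lines);
landed by the gen-6 packager in gate run 22 as `HodgeCM/PerL34/P43_leavesSmoke.lean` (import ^import Pv14g2\.PerL34\.P43Leaves\b→import HodgeCM.PerL34.P43_leaves ×1).
-/
/-
Origin: HOME/pub-hodgecm-pv14-g2/lean/Pv14g2/PerL34/P43LeavesSmoke.lean — session planner-pub-hodgecm-pv14-g2-0 (unit
pub-hodgecm-pv14-g2, DAG-NODE PROVER #14 gen 2).  Intended final place: `HodgeCM/PerL34/P43_leavesSmoke.lean`, AFTER my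
`P43Leaves.lean` (ba24781a → `HodgeCM.PerL34.P43_leaves`).  PACKAGER: `import Pv14g2.PerL34.P43Leaves` becomes
`import HodgeCM.PerL34.P43_leaves`.  KERNEL vacuity guard; nothing in this file is used by the main chain.
-/
import Summits.HodgeConjecture.HodgeCM.PerL34.P43_leaves

/-!
# The Weil-level hypothesis set of seam S1 is jointly satisfiable WITH a non-zero theta vector

A vacuity guard one level BELOW pv03's `BallSpansSmoke` (which witnesses pv02's five `GroupInputs` Props, i.e. the
CONCLUSION of pv14's N33b capstone): here every HYPOTHESIS of `P43Leaves.groupInputs_of_weilLeaves` — a forms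
dictionary with the datum's `Hol`, a theta-kernel model per `(i, χ)` with the datum's slices, a full `WeilTyping`
(the ten fields `Θ`, `hθ`, `hmulI/C/F`, `hcommIC/IF/CF/K`, and the typing identity
`hP : S[𝔭₊ ⊠ 𝟏] = isotypic ρ ρP ⊓ fixedSub ω_c` of pv14 `P43Isotypic`), N10 in invariant form, an (X1) record
`KTypeBridge` (simple `K`-types not embedding into `N`, generation of `P`, the slice dictionary), (X2), and the N33a
witness `θ(φ) ≠ 0` — is instantiated SIMULTANEOUSLY by closed terms over an elementary model:

* all three groups trivial (`Unit`), fibre `V = ℂ`, one index per type, `Γ = ⊤`;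
* Fock model `S = ℂ` with all actions trivial, `θ(φ) =` the constant function `φ`, `S[𝔭₊ ⊠ 𝟏] = ⊤`
  (`= isotypic ⊓ fixedSub` for the trivial actions on `P = ℂ`), `Θ = id`;
* forms dictionary `Pminus = ∅`, `Cochain = Hol = ⊤`;
* `K`-type record: `R = ℂ`, `F_{0,0} = F_{1,1} = ℂ` (simple), `N = PUnit` (so nothing embeds), `P = ℂ` (generated by
  `id`), `act = 0`, `ι = 0`.

Hence the capstone FIRES on a concrete instance (`smoke_groupInputs`, `smoke_n33b`): none of its hypotheses is
contradictory on its own or jointly, and they do not secretly force `θ = 0` (`smoke_theta_ne_zero`).  What this does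
NOT say: that PerL's actual objects satisfy them — that is the dictionary D2/D4/D6 (record fields labelled SETUP /
DEFINITIONAL / PRINT in `P43_leaves`, `P43_weilModel`, `CharSpansWeil`).
-/

set_option autoImplicit false

noncomputable section

namespace HodgeCM
namespace PerL34
namespace P43LeavesSmoke

open HodgeCM.PerL34.P43Leaves HodgeCM.PerL34.P43WeilModel HodgeCM.PerL34.P43Isotypic

/-- `φ ↦` the constant function `φ`. -/
def const (G : Type) : ℂ →ₗ[ℂ] (G → ℂ) where
  toFun φ := fun _ => φ
  map_add' _ _ := rfl
  map_smul' _ _ := rfl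

/-- (Ported verbatim from the HodgeCMPerL package; no docstring in the source.) -/
@[simp] theorem const_apply (G : Type) (φ : ℂ) (x : G) : const G φ x = φ := rfl

/-- The toy theta-kernel model: trivial actions, `θ(φ) = const φ`, every vector of type `𝔭₊ ⊠ 𝟏`. -/
abbrev toyK : P43Forms.ThetaKernelData Unit Unit Unit ℂ ℂ where
  ωf := fun _ => LinearMap.id
  ωc := fun _ => LinearMap.id
  theta := const (Unit × Unit × Unit)
  Ptype := ⊤

/-- The toy `LineSpanData`: trivial groups, fibre `ℂ`, `Γ = ⊤`, one index per type, slices `θ(⊤)`, `Hol = ⊤`. -/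
abbrev toyD : P43.LineSpanData where
  Ginf := Unit
  Gc := Unit
  Gf := Unit
  V := ℂ
  Γ := ⊤
  X := fun _ => Unit
  ThetaP := fun _ _ => toyK.ThetaP
  Hol := ⊤

/-- The toy forms dictionary: no `𝔭₋` operators, everything a cochain, everything holomorphic. -/
abbrev toyFD : P43Forms.FormsDictionary toyD.Ginf toyD.V where
  Pminus := ∅
  Cochain := ⊤
  Hol := ⊤

/-- The Fock model types per datum. -/
abbrev toyS : (i : Fin 2) → toyD.X i → Type := fun _ _ => ℂ

/-- The theta-kernel models per datum. -/
abbrev toyKf : (i : Fin 2) → (χ : toyD.X i) → P43Forms.ThetaKernelData toyD.Ginf toyD.Gc toyD.Gf toyD.V (toyS i χ) :=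
  fun _ _ => toyK

/-- `K_c`-action on `𝔭₊` (trivial, `K_c = Unit`, `𝔭₊ = ℂ`). -/
abbrev toyρP : Unit → ℂ →ₗ[ℂ] ℂ := fun _ => LinearMap.id

/-- `ω|_{G_∞}` (trivial). -/
abbrev toyωinf : (i : Fin 2) → (χ : toyD.X i) → toyD.Ginf → toyS i χ →ₗ[ℂ] toyS i χ :=
  fun _ _ _ => LinearMap.id

/-- `ω|_{K_c}` (trivial). -/
abbrev toyρ : (i : Fin 2) → (χ : toyD.X i) → Unit → toyS i χ →ₗ[ℂ] toyS i χ := fun _ _ _ => LinearMap.id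

/-- (Ported verbatim from the HodgeCMPerL package; no docstring in the source.) -/
theorem isotypic_triv_eq_top :
    isotypic (S := ℂ) (P := ℂ) (fun _ : Unit => LinearMap.id) (fun _ : Unit => LinearMap.id) = ⊤ := by
  refine eq_top_iff.2 fun φ _ => ?_
  have hid : IsKHom (S := ℂ) (P := ℂ) (fun _ : Unit => LinearMap.id) (fun _ : Unit => LinearMap.id)
      LinearMap.id := fun _ => rfl
  exact mem_isotypic_of_range _ _ hid φ

/-- (Ported verbatim from the HodgeCMPerL package; no docstring in the source.) -/
theorem fixedSub_triv_eq_top : fixedSub (S := ℂ) (fun _ : Unit => (LinearMap.id : ℂ →ₗ[ℂ] ℂ)) = ⊤ :=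
  eq_top_iff.2 fun φ _ => (mem_fixedSub _ φ).2 fun _ => rfl

/-- **The Weil typing of the toy datum** — all ten fields discharged. -/
def toyW (i : Fin 2) (χ : toyD.X i) : WeilTyping (toyKf i χ) (toyωinf i χ) (toyρ i χ) toyρP where
  Θ := LinearMap.id
  hθ _ _ := rfl
  hmulI _ _ := rfl
  hmulC _ _ := rfl
  hmulF _ _ := rfl
  hcommIC _ _ := rfl
  hcommIF _ _ := rfl
  hcommCF _ _ := rfl
  hcommK _ _ := rfl
  hP := by
    show (⊤ : Submodule ℂ ℂ) = isotypic (fun _ : Unit => LinearMap.id) (fun _ : Unit => LinearMap.id) ⊓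
      fixedSub (fun _ : Unit => (LinearMap.id : ℂ →ₗ[ℂ] ℂ))
    rw [isotypic_triv_eq_top, fixedSub_triv_eq_top, top_inf_eq]

/-- N10 in invariant form for the toy datum (`Γ = ⊤`, all actions trivial). -/
theorem toy_hΘ (i : Fin 2) (χ : toyD.X i) :
    ∀ γ ∈ toyD.Γ, (toyW i χ).Θ ∘ₗ (toyωinf i χ γ.1 ∘ₗ (toyKf i χ).ωc γ.2.1 ∘ₗ (toyKf i χ).ωf γ.2.2) =
      (toyW i χ).Θ :=
  fun _ _ => rfl

/-- (Ported verbatim from the HodgeCMPerL package; no docstring in the source.) -/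
theorem generatedBy_self_eq_top : P43X1Bridge.generatedBy ℂ ℂ ℂ = ⊤ :=
  eq_top_iff.2 fun x _ =>
    (le_iSup (fun f : ℂ →ₗ[ℂ] ℂ => LinearMap.range f) LinearMap.id) (LinearMap.mem_range_self _ x)

/-- (Ported verbatim from the HodgeCMPerL package; no docstring in the source.) -/
theorem noEmbedding_punit : P43KTypes.NoEmbedding ℂ ℂ PUnit := fun g hg =>
  zero_ne_one (hg (Subsingleton.elim (g 0) (g 1)))

/-- **The (X1) record of the toy datum** — all fields discharged. -/
def toyX1 (i : Fin 2) (χ : toyD.X i) : KTypeBridge toyFD (toyKf i χ) where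
  R := ℂ
  M₀ := ℂ
  M₁ := ℂ
  N := PUnit
  P := ℂ
  h₀ := noEmbedding_punit
  h₁ := noEmbedding_punit
  hgen := by rw [generatedBy_self_eq_top, top_sup_eq]
  act := 0
  ι := 0
  hdict X hX := ((Set.mem_empty_iff_false X).1 hX).elim
  hCoch _ _ := Submodule.mem_top

/-- (X2) for the toy dictionary (`Hol = ⊤`). -/
theorem toy_hX2 : P43Forms.HolomorphicOfPminus toyFD := fun _ _ _ => Submodule.mem_top

/-- The theta map of the toy model does not vanish on `S[𝔭₊ ⊠ 𝟏]`: `θ(1) = const 1 ≠ 0`. -/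
theorem smoke_theta_ne_zero : toyK.theta 1 ≠ 0 := fun h =>
  one_ne_zero (show (1 : ℂ) = 0 from by simpa using congrFun h ((), (), ()))

/-- The N33a witness in the shape of `groupInputs_of_weilLeaves`. -/
theorem toy_hne : ∀ i : Fin 2, ∃ χ : toyD.X i, ∃ φ ∈ (toyKf i χ).Ptype, (toyKf i χ).theta φ ≠ 0 :=
  fun _ => ⟨(), 1, Submodule.mem_top, smoke_theta_ne_zero⟩

/-- **The capstone fires on the toy instance**: every hypothesis of `P43Leaves.groupInputs_of_weilLeaves` is a
closed term here, so the hypothesis set is jointly satisfiable together with `θ ≠ 0`. -/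
theorem smoke_groupInputs :
    toyD.LeftInvariant ∧ toyD.CompactInvariant ∧ toyD.FiniteStable ∧ toyD.UHolomorphic ∧ toyD.SomeNonzero :=
  groupInputs_of_weilLeaves toyD toyS toyKf (fun _ _ => rfl) toyFD rfl toyρP toyωinf toyρ toyW toy_hΘ
    (fun i χ => ⟨toyX1 i χ⟩) toy_hX2 toy_hne

/-- N33b on the toy instance, from the same closed terms. -/
theorem smoke_n33b (i : Fin 2) (χ : toyD.X i) : P43Forms.N33b_statement toyFD (toyKf i χ) toyD.Γ :=
  n33b_of_weilLeaves toyD toyS toyKf toyFD toyρP toyωinf toyρ toyW toy_hΘ (fun i χ => ⟨toyX1 i χ⟩) toy_hX2 i χ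

/-- **Joint satisfiability, stated**: there are a line-span datum and, over it, closed instances of every binder of
the capstone (recorded as the firing above) whose theta map is non-zero on the type-`𝔭₊ ⊠ 𝟏` vectors and whose five
group inputs hold. -/
theorem weilLeaves_satisfiable :
    ∃ D : P43.LineSpanData, (∀ i : Fin 2, ∃ χ : D.X i, D.ThetaP i χ ≠ ⊥) ∧
      D.LeftInvariant ∧ D.CompactInvariant ∧ D.FiniteStable ∧ D.UHolomorphic ∧ D.SomeNonzero :=
  ⟨toyD, smoke_groupInputs.2.2.2.2, smoke_groupInputs⟩

end P43LeavesSmoke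
end PerL34
end HodgeCM

end
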